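import Summits.Ventures.PercRepro.RankLevelSetHallRuleLPavingParts

/-!
# PercRepro — THE BAD-SET COUNT ON A PAVING SET: `#{(q−1)-subsets of G not closed in G} ≤ C(#G, q)` (p4, gen 31;
C-044, UP form at the tight layer; paper proofs/P4-CELL-THREE.md §14.14)

`G ⊆ E` finite of rank `q ≥ 1`, paving (every `≤ (q−1)`-subset independent); the bad sets, hyperplane parts `H(A)` and
complement parts `K(A)` are those of RankLevelSetHallRuleLPavingParts, `a := #G − q`.
THE COUNT: `#bad ≤ C(#G, q)`.  Proof — a fractional matching of the bad sets into the `a`-subsets `L` of `G`: the bad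
set `A` is ADJACENT to the `a`-subsets `L` with `#(K(A) ∖ L) = 1` — there are at least `#K(A) · C(#H(A), q−1)` of them
(`L = G ∖ insert u J`, `u ∈ K(A)`, `J` a `(q−1)`-subset of `H(A)`; `card_adjSets_ge`) — and sends each of them the
weight `1 / (#K(A) · C(#H(A), q−1))`, so every bad set sends weight `≥ 1` (`one_le_sum_badWeight`).  An `a`-set `L`
receives, from the bad sets with a given complement part `K`, at most `C(#H, q−1) · 1/(#K · C(#H, q−1)) = 1/#K` (they are
`(q−1)`-subsets of `H = G ∖ K`); the distinct complement parts `K` adjacent to `L` satisfy `K ∪ K′ ⊇ L` (from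
`#(H ∩ H′) ≤ q − 2`), so the sets `L ∖ K` are pairwise disjoint, `Σ_K #(L ∖ K) ≤ a`, and with `1/#K ≤ #(L ∖ K)/a`
(`a ≤ s(a + 1 − s)` for `1 ≤ s ≤ a`, `s = #K = a + 1 − #(L ∖ K)`) every `L` receives at most `1`
(`sum_badWeight_le_one`).  Hence `#bad ≤ #{a-subsets of G} = C(#G, q)` (**`card_badSets_le_choose`**).
Axioms standard.
-/

namespace PercRepro

open Set Matroid Finset

variable {α : Type} [DecidableEq α] (M : Matroid α)

/-- The `a`-subsets of `G` (`a = #G − q`) **adjacent** to the bad set `A`: those `L` with `#(K(A) ∖ L) = 1`. -/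
noncomputable def adjSets (q : ℕ) (G A : Finset α) : Finset (Finset α) :=
  (G.powersetCard (G.card - q)).filter (fun L => (compPart M G A \ L).card = 1)

/-- `K ∖ (G ∖ X) = K ∩ X` for `K ⊆ G`. -/
lemma sdiff_sdiff_eq_inter_of_subset {G K X : Finset α} (hK : K ⊆ G) : K \ (G \ X) = K ∩ X := by
  ext x
  simp only [Finset.mem_sdiff, Finset.mem_inter, not_and, not_not]
  constructor
  · rintro ⟨hxK, h⟩; exact ⟨hxK, h (hK hxK)⟩
  · rintro ⟨hxK, hxX⟩; exact ⟨hxK, fun _ => hxX⟩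

/-- **The adjacency count**: the bad set `A` is adjacent to at least `#K(A) · C(#H(A), q−1)` of the `a`-subsets —
`L = G ∖ insert u J` for `u ∈ K(A)` and `J` a `(q−1)`-subset of `H(A)`. -/
lemma card_adjSets_ge {q : ℕ} (hq : 1 ≤ q) (G A : Finset α) :
    (compPart M G A).card * (hypPart M G A).card.choose (q - 1) ≤ (adjSets M q G A).card := by
  classical
  set K := compPart M G A with hK
  set H := hypPart M G A with hH
  have hKG : K ⊆ G := compPart_subset M G A
  have hHG : H ⊆ G := hypPart_subset M G A
  have hdisj : Disjoint H K := disjoint_hypPart_compPart M G A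
  let f : α × Finset α → Finset α := fun x => G \ insert x.1 x.2
  have hcardins : ∀ x ∈ K ×ˢ H.powersetCard (q - 1), (insert x.1 x.2).card = q ∧ insert x.1 x.2 ⊆ G ∧ x.1 ∉ x.2 := by
    rintro ⟨u, J⟩ hx
    rw [Finset.mem_product, Finset.mem_powersetCard] at hx
    have huJ : u ∉ J := fun h => Finset.disjoint_left.1 hdisj (hx.2.1 h) hx.1
    refine ⟨?_, Finset.insert_subset (hKG hx.1) (hx.2.1.trans hHG), huJ⟩
    rw [Finset.card_insert_of_notMem huJ, hx.2.2]
    omega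
  have hmaps : ∀ x ∈ K ×ˢ H.powersetCard (q - 1), f x ∈ adjSets M q G A := by
    rintro ⟨u, J⟩ hx
    obtain ⟨hcard, hsub, huJ⟩ := hcardins ⟨u, J⟩ hx
    rw [Finset.mem_product, Finset.mem_powersetCard] at hx
    unfold adjSets
    rw [Finset.mem_filter, Finset.mem_powersetCard]
    refine ⟨⟨Finset.sdiff_subset, ?_⟩, ?_⟩
    · show (G \ insert u J).card = G.card - q
      rw [Finset.card_sdiff_of_subset hsub, hcard]
    · show (K \ (G \ insert u J)).card = 1
      rw [sdiff_sdiff_eq_inter_of_subset hKG]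
      have : K ∩ insert u J = {u} := by
        ext x
        simp only [Finset.mem_inter, Finset.mem_insert, Finset.mem_singleton]
        constructor
        · rintro ⟨hxK, hxu | hxJ⟩
          · exact hxu
          · exact absurd (hx.2.1 hxJ) (Finset.disjoint_right.1 hdisj hxK)
        · rintro rfl; exact ⟨hx.1, Or.inl rfl⟩
      rw [this, Finset.card_singleton]
  have hinj : Set.InjOn f ↑(K ×ˢ H.powersetCard (q - 1)) := by
    rintro ⟨u, J⟩ hx ⟨u', J'⟩ hx' heq
    rw [Finset.mem_coe] at hx hx'
    obtain ⟨-, hsub, huJ⟩ := hcardins ⟨u, J⟩ hx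
    obtain ⟨-, hsub', huJ'⟩ := hcardins ⟨u', J'⟩ hx'
    have h1 : insert u J = insert u' J' := by
      have e1 : insert u J = G \ (G \ insert u J) := (Finset.sdiff_sdiff_eq_self hsub).symm
      have e2 : insert u' J' = G \ (G \ insert u' J') := (Finset.sdiff_sdiff_eq_self hsub').symm
      rw [e1, e2]
      exact congrArg (fun T => G \ T) heq
    rw [Finset.mem_product, Finset.mem_powersetCard] at hx hx'
    have huu : u = u' := by
      have : u ∈ insert u' J' := by rw [← h1]; exact Finset.mem_insert_self u J
      rw [Finset.mem_insert] at this
      rcases this with h | h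
      · exact h
      · exact absurd (hx'.2.1 h) (Finset.disjoint_right.1 hdisj hx.1)
    subst huu
    have hJ : J = J' := by
      have := congrArg (fun T => T.erase u) h1
      simpa [Finset.erase_insert huJ, Finset.erase_insert huJ'] using this
    rw [hJ]
  calc K.card * H.card.choose (q - 1) = (K ×ˢ H.powersetCard (q - 1)).card := by
        rw [Finset.card_product, Finset.card_powersetCard]
    _ = ((K ×ˢ H.powersetCard (q - 1)).image f).card := (Finset.card_image_of_injOn hinj).symm
    _ ≤ (adjSets M q G A).card := Finset.card_le_card (Finset.image_subset_iff.2 hmaps)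

/-- The weight a bad set sends to each adjacent `a`-subset: `1 / (#K(A) · C(#H(A), q−1))`. -/
noncomputable def badWeight (q : ℕ) (G A : Finset α) : ℚ :=
  1 / (((compPart M G A).card : ℚ) * (((hypPart M G A).card.choose (q - 1) : ℕ) : ℚ))

/-- The weights are non-negative. -/
lemma badWeight_nonneg (q : ℕ) (G A : Finset α) : 0 ≤ badWeight M q G A := by
  unfold badWeight; positivity

/-- Every bad set sends total weight at least `1` to its adjacent `a`-subsets. -/
lemma one_le_sum_badWeight {q : ℕ} (hq : 1 ≤ q) {G A : Finset α} (hGE : (G : Set α) ⊆ M.E)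
    (hrk : M.eRk (G : Set α) = (q : ℕ∞)) (hpav : ∀ A : Finset α, A ⊆ G → A.card ≤ q - 1 → M.Indep (A : Set α))
    (hA : A ∈ badSets M q G) : 1 ≤ ∑ _L ∈ adjSets M q G A, badWeight M q G A := by
  rw [Finset.sum_const, nsmul_eq_mul]
  have hs : 1 ≤ (compPart M G A).card := card_compPart_pos M hq hrk hpav hA
  have hc : 0 < (hypPart M G A).card.choose (q - 1) :=
    Nat.choose_pos (by have := card_hypPart_ge M hq hGE hA; omega)
  have hadj := card_adjSets_ge M hq G A
  have hpos : (0 : ℚ) < ((compPart M G A).card : ℚ) * (((hypPart M G A).card.choose (q - 1) : ℕ) : ℚ) := by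
    have h1 : (0 : ℚ) < (compPart M G A).card := by exact_mod_cast hs
    have h2 : (0 : ℚ) < (((hypPart M G A).card.choose (q - 1) : ℕ) : ℚ) := by exact_mod_cast hc
    positivity
  unfold badWeight
  rw [mul_one_div, le_div_iff₀ hpos, one_mul]
  exact_mod_cast hadj

/-- `1/s ≤ (a + 1 − s)/a` for `1 ≤ s ≤ a`. -/
lemma one_div_le_of_le {a s : ℕ} (hs : 1 ≤ s) (hsa : s ≤ a) :
    (1 : ℚ) / s ≤ ((a + 1 - s : ℕ) : ℚ) / a := by
  have ha : (1 : ℚ) ≤ a := by exact_mod_cast le_trans hs hsa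
  have hs' : (1 : ℚ) ≤ s := by exact_mod_cast hs
  have hsa' : (s : ℚ) ≤ a := by exact_mod_cast hsa
  have hcast : ((a + 1 - s : ℕ) : ℚ) = (a : ℚ) + 1 - s := by
    rw [Nat.cast_sub (by omega)]; push_cast; ring
  rw [hcast, div_le_div_iff₀ (by linarith) (by linarith), one_mul]
  nlinarith [mul_nonneg (sub_nonneg.2 hs') (sub_nonneg.2 hsa')]

/-- **Every `a`-subset `L` receives total weight at most `1`** from the bad sets adjacent to it. -/
lemma sum_badWeight_le_one {q : ℕ} (hq : 1 ≤ q) {G : Finset α} (hGE : (G : Set α) ⊆ M.E)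
    (hrk : M.eRk (G : Set α) = (q : ℕ∞)) (hpav : ∀ A : Finset α, A ⊆ G → A.card ≤ q - 1 → M.Indep (A : Set α))
    (hapos : 1 ≤ G.card - q) {L : Finset α} (hL : L ∈ G.powersetCard (G.card - q)) :
    ∑ A ∈ (badSets M q G).filter (fun A => (compPart M G A \ L).card = 1), badWeight M q G A ≤ 1 := by
  classical
  set a := G.card - q with ha
  rw [Finset.mem_powersetCard] at hL
  set badL := (badSets M q G).filter (fun A => (compPart M G A \ L).card = 1) with hbadL
  have hmem : ∀ A ∈ badL, A ∈ badSets M q G ∧ (compPart M G A \ L).card = 1 := by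
    intro A hA
    rw [hbadL, Finset.mem_filter] at hA
    exact hA
  set 𝒦 := badL.image (compPart M G) with h𝒦
  -- fibrewise over the complement parts
  rw [← Finset.sum_fiberwise_of_maps_to (fun A hA => Finset.mem_image_of_mem (compPart M G) hA) (badWeight M q G)]
  -- each fibre contributes at most 1/#K
  have hfibre : ∀ K ∈ 𝒦, ∑ A ∈ badL.filter (fun A => compPart M G A = K), badWeight M q G A ≤ 1 / (K.card : ℚ) := by
    intro K hK
    rw [h𝒦, Finset.mem_image] at hK
    obtain ⟨A₀, hA₀, rfl⟩ := hK
    obtain ⟨hA₀bad, -⟩ := hmem A₀ hA₀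
    have hspos : 1 ≤ (compPart M G A₀).card := card_compPart_pos M hq hrk hpav hA₀bad
    have hcpos : 0 < (hypPart M G A₀).card.choose (q - 1) :=
      Nat.choose_pos (by have := card_hypPart_ge M hq hGE hA₀bad; omega)
    -- the weights on the fibre all equal badWeight A₀
    have hconst : ∀ A ∈ badL.filter (fun A => compPart M G A = compPart M G A₀),
        badWeight M q G A = badWeight M q G A₀ := by
      intro A hA
      rw [Finset.mem_filter] at hA
      unfold badWeight
      rw [hA.2, card_hypPart_eq, card_hypPart_eq (A := A₀), hA.2]
    rw [Finset.sum_congr rfl hconst, Finset.sum_const, nsmul_eq_mul]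
    -- the fibre has at most C(#H(A₀), q−1) elements
    have hcard : (badL.filter (fun A => compPart M G A = compPart M G A₀)).card ≤ (hypPart M G A₀).card.choose (q - 1) := by
      rw [← Finset.card_powersetCard]
      refine Finset.card_le_card ?_
      intro A hA
      rw [Finset.mem_filter] at hA
      obtain ⟨hAbad, -⟩ := hmem A hA.1
      rw [Finset.mem_powersetCard]
      refine ⟨?_, ((mem_badSets M).1 hAbad).1.2⟩
      have h1 : hypPart M G A = hypPart M G A₀ := by
        rw [hypPart_eq_sdiff_compPart, hypPart_eq_sdiff_compPart (A := A₀), hA.2]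
      rw [← h1]
      exact subset_hypPart_of_mem_badSets M hGE hAbad
    unfold badWeight
    have hpos : (0 : ℚ) < (((hypPart M G A₀).card.choose (q - 1) : ℕ) : ℚ) := by exact_mod_cast hcpos
    have hspos' : (0 : ℚ) < (compPart M G A₀).card := by exact_mod_cast hspos
    calc ((badL.filter (fun A => compPart M G A = compPart M G A₀)).card : ℚ) *
          (1 / (((compPart M G A₀).card : ℚ) * (((hypPart M G A₀).card.choose (q - 1) : ℕ) : ℚ)))
        ≤ (((hypPart M G A₀).card.choose (q - 1) : ℕ) : ℚ) *
          (1 / (((compPart M G A₀).card : ℚ) * (((hypPart M G A₀).card.choose (q - 1) : ℕ) : ℚ))) := by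
          refine mul_le_mul_of_nonneg_right ?_ (by positivity)
          exact_mod_cast hcard
      _ = 1 / ((compPart M G A₀).card : ℚ) := by
          field_simp
  -- the complement parts adjacent to L: 1/#K ≤ #(L ∖ K)/a, and the sets L ∖ K are pairwise disjoint
  have hterm : ∀ K ∈ 𝒦, (1 : ℚ) / (K.card : ℚ) ≤ ((L \ K).card : ℚ) / (a : ℚ) := by
    intro K hK
    rw [h𝒦, Finset.mem_image] at hK
    obtain ⟨A₀, hA₀, rfl⟩ := hK
    obtain ⟨hA₀bad, hadj⟩ := hmem A₀ hA₀
    have hs1 : 1 ≤ (compPart M G A₀).card := card_compPart_pos M hq hrk hpav hA₀bad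
    have hsa : (compPart M G A₀).card ≤ a := card_compPart_le M hq hGE hA₀bad
    have hsplit : (compPart M G A₀ \ L).card + (compPart M G A₀ ∩ L).card = (compPart M G A₀).card :=
      Finset.card_sdiff_add_card_inter _ _
    have hLK : (L \ compPart M G A₀).card = L.card - (compPart M G A₀ ∩ L).card := Finset.card_sdiff
    have hLcard : L.card = a := hL.2
    have hLK' : (L \ compPart M G A₀).card = a + 1 - (compPart M G A₀).card := by omega
    rw [hLK']
    exact one_div_le_of_le hs1 hsa
  have hdisj : (𝒦 : Set (Finset α)).PairwiseDisjoint (fun K => L \ K) := by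
    intro K hK K' hK' hne
    rw [Finset.mem_coe, h𝒦, Finset.mem_image] at hK hK'
    obtain ⟨A₀, hA₀, rfl⟩ := hK
    obtain ⟨A₁, hA₁, rfl⟩ := hK'
    obtain ⟨hA₀bad, hadj₀⟩ := hmem A₀ hA₀
    obtain ⟨hA₁bad, hadj₁⟩ := hmem A₁ hA₁
    have hge := card_union_compPart_ge M hpav hA₀bad hA₁bad hne
    have hsub : compPart M G A₀ ∪ compPart M G A₁ ⊆ L ∪ (compPart M G A₀ \ L) ∪ (compPart M G A₁ \ L) := by
      intro x hx
      rw [Finset.mem_union] at hx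
      simp only [Finset.mem_union, Finset.mem_sdiff]
      by_cases hxL : x ∈ L
      · exact Or.inl (Or.inl hxL)
      · rcases hx with hx | hx
        · exact Or.inl (Or.inr ⟨hx, hxL⟩)
        · exact Or.inr ⟨hx, hxL⟩
    have hcardle : (L ∪ (compPart M G A₀ \ L) ∪ (compPart M G A₁ \ L)).card ≤ a + 2 := by
      calc (L ∪ (compPart M G A₀ \ L) ∪ (compPart M G A₁ \ L)).card
          ≤ (L ∪ (compPart M G A₀ \ L)).card + (compPart M G A₁ \ L).card := Finset.card_union_le _ _
        _ ≤ L.card + (compPart M G A₀ \ L).card + (compPart M G A₁ \ L).card := by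
            have := Finset.card_union_le L (compPart M G A₀ \ L); omega
        _ = a + 2 := by rw [hL.2, hadj₀, hadj₁]
    have hqn : q ≤ G.card := by omega
    have heq : compPart M G A₀ ∪ compPart M G A₁ = L ∪ (compPart M G A₀ \ L) ∪ (compPart M G A₁ \ L) :=
      Finset.eq_of_subset_of_card_le hsub (by omega)
    have hLsub : L ⊆ compPart M G A₀ ∪ compPart M G A₁ := by
      rw [heq]; exact (Finset.subset_union_left).trans Finset.subset_union_left
    show Disjoint (L \ compPart M G A₀) (L \ compPart M G A₁)
    rw [Finset.disjoint_left]
    intro x hx hx'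
    rw [Finset.mem_sdiff] at hx hx'
    rcases Finset.mem_union.1 (hLsub hx.1) with h | h
    · exact hx.2 h
    · exact hx'.2 h
  have hbi : ∑ K ∈ 𝒦, ((L \ K).card : ℚ) ≤ (a : ℚ) := by
    have h1 : ∑ K ∈ 𝒦, (L \ K).card = (𝒦.biUnion (fun K => L \ K)).card := (Finset.card_biUnion hdisj).symm
    have h2 : (𝒦.biUnion (fun K => L \ K)).card ≤ L.card := by
      refine Finset.card_le_card ?_
      intro x hx
      rw [Finset.mem_biUnion] at hx
      obtain ⟨K, -, hxK⟩ := hx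
      exact (Finset.mem_sdiff.1 hxK).1
    rw [hL.2] at h2
    exact_mod_cast h1 ▸ h2
  have hapos' : (0 : ℚ) < a := by exact_mod_cast hapos
  calc ∑ K ∈ 𝒦, ∑ A ∈ badL.filter (fun A => compPart M G A = K), badWeight M q G A
      ≤ ∑ K ∈ 𝒦, (1 : ℚ) / (K.card : ℚ) := Finset.sum_le_sum hfibre
    _ ≤ ∑ K ∈ 𝒦, ((L \ K).card : ℚ) / (a : ℚ) := Finset.sum_le_sum hterm
    _ = (∑ K ∈ 𝒦, ((L \ K).card : ℚ)) / (a : ℚ) := by rw [Finset.sum_div]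
    _ ≤ (a : ℚ) / (a : ℚ) := by
        rw [div_le_div_iff_of_pos_right hapos']
        exact hbi
    _ = 1 := div_self hapos'.ne'

/-- **THE BAD-SET COUNT ON A PAVING SET**: if `G ⊆ E` has rank `q ≥ 1` and every subset of `G` with at most `q − 1`
elements is independent, then the `(q−1)`-subsets of `G` that are not closed in `G` number at most `C(#G, q)`. -/
theorem card_badSets_le_choose {q : ℕ} (hq : 1 ≤ q) {G : Finset α} (hGE : (G : Set α) ⊆ M.E)
    (hrk : M.eRk (G : Set α) = (q : ℕ∞)) (hpav : ∀ A : Finset α, A ⊆ G → A.card ≤ q - 1 → M.Indep (A : Set α)) :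
    (badSets M q G).card ≤ G.card.choose q := by
  classical
  have hqn : q ≤ G.card := by
    have h := M.eRk_le_encard (G : Set α)
    rw [hrk, Set.encard_coe_eq_coe_finsetCard] at h
    exact_mod_cast h
  by_cases ha0 : G.card - q = 0
  · have hempty : badSets M q G = ∅ := by
      rw [Finset.eq_empty_iff_forall_notMem]
      intro A hA
      have h1 := card_compPart_pos M hq hrk hpav hA
      have h2 := card_compPart_le M hq hGE hA
      omega
    rw [hempty, Finset.card_empty]
    exact Nat.zero_le _
  have hapos : 1 ≤ G.card - q := by omega
  -- the double count in ℚ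
  have hmain : ((badSets M q G).card : ℚ) ≤ ((G.powersetCard (G.card - q)).card : ℚ) := by
    calc ((badSets M q G).card : ℚ) = ∑ _A ∈ badSets M q G, (1 : ℚ) := by
          rw [Finset.sum_const, nsmul_eq_mul, mul_one]
      _ ≤ ∑ A ∈ badSets M q G, ∑ _L ∈ adjSets M q G A, badWeight M q G A :=
          Finset.sum_le_sum (fun A hA => one_le_sum_badWeight M hq hGE hrk hpav hA)
      _ = ∑ A ∈ badSets M q G, ∑ L ∈ G.powersetCard (G.card - q),
            (if (compPart M G A \ L).card = 1 then badWeight M q G A else 0) := by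
          refine Finset.sum_congr rfl (fun A _ => ?_)
          unfold adjSets
          rw [Finset.sum_filter]
      _ = ∑ L ∈ G.powersetCard (G.card - q), ∑ A ∈ badSets M q G,
            (if (compPart M G A \ L).card = 1 then badWeight M q G A else 0) := Finset.sum_comm
      _ = ∑ L ∈ G.powersetCard (G.card - q),
            ∑ A ∈ (badSets M q G).filter (fun A => (compPart M G A \ L).card = 1), badWeight M q G A := by
          refine Finset.sum_congr rfl (fun L _ => ?_)
          rw [Finset.sum_filter]
      _ ≤ ∑ _L ∈ G.powersetCard (G.card - q), (1 : ℚ) :=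
          Finset.sum_le_sum (fun L hL => sum_badWeight_le_one M hq hGE hrk hpav hapos hL)
      _ = ((G.powersetCard (G.card - q)).card : ℚ) := by
          rw [Finset.sum_const, nsmul_eq_mul, mul_one]
  have h1 : (badSets M q G).card ≤ (G.powersetCard (G.card - q)).card := by exact_mod_cast hmain
  rw [Finset.card_powersetCard, Nat.choose_symm hqn] at h1
  exact h1


end PercRepro
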